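import Mathlib
import HarnessLib.Audit
import Summits.PneNP.PneNP.Theorems.PstarChordReadHubCore
import Summits.PneNP.PneNP.Theorems.PstarChordReadSharedTypes

/-!
# The hub two-chord theorem (ROUND-24, O1 beyond tightness; memo g22 §23)

FRONTIER range-avoidance ladder, rung F-N3, ROUND 24 (cell `pnp-ideate`, prover-2 memo `g22/O1-PAIRCORE-g22.md` §23; typed target
`PstarCoreBoundTargets.TerminalPeelable` (p646951); restricted-model proof complexity — nothing here bears on `P` versus `NP`).

**Theorem (`false_of_hub`).**  In a terminal core `(J₀, w₁, w₂)` of a pure instance with simple overlaps (typed, boundary-expanding), two distinct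
slice-generic chords `cᵢ, cⱼ` cannot be gated on ONE common outside variable `z` by a PURE HUB: gates `gᵢ = {vᵢ, z}`, `gⱼ = {vⱼ, z}` in the menu
`G₁ ∪ G₂` (`vᵢ, vⱼ` AND variables of `cᵢ, cⱼ`) and no other monomial of the menu touching `vᵢ, vᵢ', vⱼ, vⱼ', z` (`HubGates`).  This is the
configuration that boundary slack two makes affordable (memo §20.2: a shared partner costs nothing at slack two) and that
`PstarChordReadTwoChords.false_of_two_gated` excludes by hypothesis; it is also the `(σ, z) + (π, z)` obstruction of branch (A) at tightness.

Proof: `HubGates.hubData` computes the moves (`PstarChordReadGates.coef_switch`, `PstarChordReadSharedTypes.coef_switch₂`) and delivers the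
abstract `PstarChordReadHubCore.HubData` for ANY pair of readers with menu `G₁ ∪ G₂`; the gate types `([gᵢ ∈ G₁], [gᵢ ∈ G₂]; [gⱼ ∈ G₁], [gⱼ ∈ G₂])`
(nine patterns) are moved to the two normal forms `(1,0;0,1)` (`false_of_hub_mixed`) and `(1,0;1,0)` (`false_of_hub_uniform`) by the reader
symmetries `terminal_swap` and `terminal_sum` (`GL₂(𝔽₂) ≅ S₃` acts transitively on ordered pairs of equal resp. distinct non-zero types).
No Assumption A.
-/

set_option linter.dupNamespace false -- `Summit.PneNP.PneNP.…`: summit = sub-problem name (D-0017 single-conjunct layout)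

open Finset Literature.Computability.Complexity
open scoped symmDiff
open Summit.PneNP.PneNP.Theorems.PstarTyped (Typed)
open Summit.PneNP.PneNP.Theorems.PstarSALevel (varSet bdry BoundaryExpanding SimpleOverlap)
open Summit.PneNP.PneNP.Theorems.PstarGapPeeling (not_mem_varSet_of_private)
open Summit.PneNP.PneNP.Theorems.PstarCentreFree (vars_mem_varSet)
open Summit.PneNP.PneNP.Theorems.PstarFibrePolys (bit)
open Summit.PneNP.PneNP.Theorems.PstarChordRepair (IsChord)
open Summit.PneNP.PneNP.Theorems.PstarCoreBoundTargets (Terminal)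
open Summit.PneNP.PneNP.Theorems.PstarChordReadLemma (SliceGeneric)
open Summit.PneNP.PneNP.Theorems.PstarChordReadsMirror (terminal_swap)
open Summit.PneNP.PneNP.Theorems.PstarChordReadOutsideKill (terminal_sum union_symmDiff_eq)
open Summit.PneNP.PneNP.Theorems.PstarChordReadGates (coef_switch)
open Summit.PneNP.PneNP.Theorems.PstarChordReadSharedTypes (coef_switch₂)
open Summit.PneNP.PneNP.Theorems.PstarChordReadFlip (mv)
open Summit.PneNP.PneNP.Theorems.PstarChordReadRestrictVar (avoid mem_avoid)
open Summit.PneNP.PneNP.Theorems.PstarChordReadHubCore (HubData false_of_hub_mixed false_of_hub_uniform)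

namespace Summit.PneNP.PneNP.Theorems.PstarChordReadHub

variable {n m : ℕ}

/-- **HUB GATES** (instance level, menu `M`): two distinct chords `cᵢ, cⱼ ∈ J₀` with AND pairs `(vᵢ, vᵢ')`, `(vⱼ, vⱼ')`, slice-generic for `M`,
an outside variable `z`, outputs `gᵢ = {vᵢ, z}`, `gⱼ = {vⱼ, z}`, and PURITY: every monomial of `M` with an AND variable among
`vᵢ, vᵢ', vⱼ, vⱼ', z` is `gᵢ` or `gⱼ`. -/
structure HubGates (I : LocalMap 4 n m) (y : Fin m → Bool) (J₀ M : Finset (Fin m)) (cᵢ cⱼ : Fin m) (vᵢ vᵢ' vⱼ vⱼ' z : Fin n)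
    (gᵢ gⱼ : Fin m) : Prop where
  /-- `cᵢ ∈ J₀` -/
  memᵢ : cᵢ ∈ J₀
  /-- `cⱼ ∈ J₀` -/
  memⱼ : cⱼ ∈ J₀
  /-- distinct chords -/
  ne : cᵢ ≠ cⱼ
  /-- `cᵢ` is a chord -/
  chordᵢ : IsChord I J₀ cᵢ
  /-- `cⱼ` is a chord -/
  chordⱼ : IsChord I J₀ cⱼ
  /-- AND pair of `cᵢ` -/
  pairᵢ : (I.vars cᵢ 2 = vᵢ ∧ I.vars cᵢ 3 = vᵢ') ∨ (I.vars cᵢ 2 = vᵢ' ∧ I.vars cᵢ 3 = vᵢ)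
  /-- AND pair of `cⱼ` -/
  pairⱼ : (I.vars cⱼ 2 = vⱼ ∧ I.vars cⱼ 3 = vⱼ') ∨ (I.vars cⱼ 2 = vⱼ' ∧ I.vars cⱼ 3 = vⱼ)
  /-- `z` outside the core -/
  out : ∀ j ∈ J₀, z ∉ varSet I j
  /-- `cᵢ` slice-generic for the menu -/
  genᵢ : SliceGeneric I y J₀ cᵢ M
  /-- `cⱼ` slice-generic for the menu -/
  genⱼ : SliceGeneric I y J₀ cⱼ M
  /-- the gate of `cᵢ`: AND pair `{vᵢ, z}` -/
  gateᵢ : (I.vars gᵢ 2 = vᵢ ∧ I.vars gᵢ 3 = z) ∨ (I.vars gᵢ 2 = z ∧ I.vars gᵢ 3 = vᵢ)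
  /-- the gate of `cⱼ`: AND pair `{vⱼ, z}` -/
  gateⱼ : (I.vars gⱼ 2 = vⱼ ∧ I.vars gⱼ 3 = z) ∨ (I.vars gⱼ 2 = z ∧ I.vars gⱼ 3 = vⱼ)
  /-- purity of the hub -/
  pure : ∀ h ∈ M, ∀ s : Fin 4, s = 2 ∨ s = 3 →
    (I.vars h s = vᵢ ∨ I.vars h s = vᵢ' ∨ I.vars h s = vⱼ ∨ I.vars h s = vⱼ' ∨ I.vars h s = z) → h = gᵢ ∨ h = gⱼ

namespace HubGates

variable {I : LocalMap 4 n m} {y : Fin m → Bool} {J₀ M : Finset (Fin m)} {cᵢ cⱼ : Fin m} {vᵢ vᵢ' vⱼ vⱼ' z : Fin n} {gᵢ gⱼ : Fin m}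
  (HG : HubGates I y J₀ M cᵢ cⱼ vᵢ vᵢ' vⱼ vⱼ' z gᵢ gⱼ)
include HG

/-- Transport along a menu equality. -/
theorem cast {M' : Finset (Fin m)} (h : M = M') : HubGates I y J₀ M' cᵢ cⱼ vᵢ vᵢ' vⱼ vⱼ' z gᵢ gⱼ := h ▸ HG

/-! ### Distinctness bookkeeping -/

/-- `vᵢ ≠ z`, `vᵢ' ≠ z`, `vᵢ ≠ vⱼ`, `vᵢ ≠ vⱼ'`, `vⱼ ≠ z`, `vⱼ' ≠ z`, `vⱼ ≠ vᵢ'`. -/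
theorem nes : vᵢ ≠ z ∧ vᵢ' ≠ z ∧ vᵢ ≠ vⱼ ∧ vᵢ ≠ vⱼ' ∧ vⱼ ≠ z ∧ vⱼ' ≠ z ∧ vⱼ ≠ vᵢ' := by
  -- the AND pairs lie in the `varSet`s and the privates are boundary variables (inlined: cf. `HubData.memvᵢ`)
  obtain ⟨mᵢ, mᵢ', bᵢ⟩ : vᵢ ∈ varSet I cᵢ ∧ vᵢ' ∈ varSet I cᵢ ∧ vᵢ ∈ bdry I J₀ := by
    rcases HG.pairᵢ with ⟨h2, h3⟩ | ⟨h2, h3⟩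
    · exact ⟨h2 ▸ vars_mem_varSet I cᵢ 2, h3 ▸ vars_mem_varSet I cᵢ 3, h2 ▸ HG.chordᵢ.1⟩
    · exact ⟨h3 ▸ vars_mem_varSet I cᵢ 3, h2 ▸ vars_mem_varSet I cᵢ 2, h3 ▸ HG.chordᵢ.2⟩
  obtain ⟨mⱼ, mⱼ', bⱼ⟩ : vⱼ ∈ varSet I cⱼ ∧ vⱼ' ∈ varSet I cⱼ ∧ vⱼ ∈ bdry I J₀ := by
    rcases HG.pairⱼ with ⟨h2, h3⟩ | ⟨h2, h3⟩
    · exact ⟨h2 ▸ vars_mem_varSet I cⱼ 2, h3 ▸ vars_mem_varSet I cⱼ 3, h2 ▸ HG.chordⱼ.1⟩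
    · exact ⟨h3 ▸ vars_mem_varSet I cⱼ 3, h2 ▸ vars_mem_varSet I cⱼ 2, h3 ▸ HG.chordⱼ.2⟩
  have hᵢ : vᵢ ∉ varSet I cⱼ := not_mem_varSet_of_private I HG.memᵢ HG.memⱼ HG.ne.symm bᵢ mᵢ
  have hⱼ : vⱼ ∉ varSet I cᵢ := not_mem_varSet_of_private I HG.memⱼ HG.memᵢ HG.ne bⱼ mⱼ
  have zᵢ := HG.out cᵢ HG.memᵢ
  have zⱼ := HG.out cⱼ HG.memⱼ
  exact ⟨fun e => zᵢ (e ▸ mᵢ), fun e => zᵢ (e ▸ mᵢ'), fun e => hᵢ (e ▸ mⱼ), fun e => hᵢ (e ▸ mⱼ'), fun e => zⱼ (e ▸ mⱼ),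
    fun e => zⱼ (e ▸ mⱼ'), fun e => hⱼ (e ▸ mᵢ')⟩

/-- The AND variables of `gᵢ` are `vᵢ` and `z`. -/
theorem gvarsᵢ (s : Fin 4) (hs : s = 2 ∨ s = 3) : I.vars gᵢ s = vᵢ ∨ I.vars gᵢ s = z := by
  rcases hs with rfl | rfl <;> rcases HG.gateᵢ with ⟨h2, h3⟩ | ⟨h2, h3⟩
  exacts [Or.inl h2, Or.inr h2, Or.inr h3, Or.inl h3]

/-- The AND variables of `gⱼ` are `vⱼ` and `z`. -/
theorem gvarsⱼ (s : Fin 4) (hs : s = 2 ∨ s = 3) : I.vars gⱼ s = vⱼ ∨ I.vars gⱼ s = z := by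
  rcases hs with rfl | rfl <;> rcases HG.gateⱼ with ⟨h2, h3⟩ | ⟨h2, h3⟩
  exacts [Or.inl h2, Or.inr h2, Or.inr h3, Or.inl h3]

/-- The two gates are different outputs. -/
theorem gne : gᵢ ≠ gⱼ := by
  obtain ⟨hᵢz, -, hᵢⱼ, -, hⱼz, -⟩ := HG.nes
  intro e
  rcases HG.gateᵢ with ⟨a2, a3⟩ | ⟨a2, a3⟩ <;> rcases HG.gateⱼ with ⟨b2, b3⟩ | ⟨b2, b3⟩
  · exact hᵢⱼ (a2.symm.trans (e ▸ b2))
  · exact hᵢz (a2.symm.trans (e ▸ b2))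
  · exact hⱼz (b2.symm.trans (e ▸ a2))
  · exact hᵢⱼ (a3.symm.trans (e ▸ b3))

/-- No monomial of `G ⊆ M` other than `gᵢ` has `vᵢ` as an AND variable. -/
theorem otherᵢ {G : Finset (Fin m)} (hG : G ⊆ M) : ∀ g' ∈ G, g' ≠ gᵢ → I.vars g' 2 ≠ vᵢ ∧ I.vars g' 3 ≠ vᵢ := by
  obtain ⟨hᵢz, -, hᵢⱼ, -⟩ := HG.nes
  intro g' hg' hne
  have key : ∀ s : Fin 4, s = 2 ∨ s = 3 → I.vars g' s ≠ vᵢ := by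
    intro s hs e
    rcases HG.pure g' (hG hg') s hs (Or.inl e) with h | h
    · exact hne h
    · subst h
      rcases HG.gvarsⱼ s hs with h' | h'
      · exact hᵢⱼ (e.symm.trans h')
      · exact hᵢz (e.symm.trans h')
  exact ⟨key 2 (Or.inl rfl), key 3 (Or.inr rfl)⟩

/-- No monomial of `G ⊆ M` other than `gⱼ` has `vⱼ` as an AND variable. -/
theorem otherⱼ {G : Finset (Fin m)} (hG : G ⊆ M) : ∀ g' ∈ G, g' ≠ gⱼ → I.vars g' 2 ≠ vⱼ ∧ I.vars g' 3 ≠ vⱼ := by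
  obtain ⟨-, -, hᵢⱼ, -, hⱼz, -⟩ := HG.nes
  intro g' hg' hne
  have key : ∀ s : Fin 4, s = 2 ∨ s = 3 → I.vars g' s ≠ vⱼ := by
    intro s hs e
    rcases HG.pure g' (hG hg') s hs (Or.inr (Or.inr (Or.inl e))) with h | h
    · subst h
      rcases HG.gvarsᵢ s hs with h' | h'
      · exact hᵢⱼ (h'.symm.trans e)
      · exact hⱼz (e.symm.trans h')
    · exact hne h
  exact ⟨key 2 (Or.inl rfl), key 3 (Or.inr rfl)⟩

/-- No monomial of `G ⊆ M` other than `gᵢ, gⱼ` contains `z`. -/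
theorem otherz {G : Finset (Fin m)} (hG : G ⊆ M) : ∀ h ∈ G, h ≠ gᵢ → h ≠ gⱼ → I.vars h 2 ≠ z ∧ I.vars h 3 ≠ z := by
  intro h hh h1 h2
  have key : ∀ s : Fin 4, s = 2 ∨ s = 3 → I.vars h s ≠ z := fun s hs e => by
    rcases HG.pure h (hG hh) s hs (Or.inr (Or.inr (Or.inr (Or.inr e)))) with e' | e'
    exacts [h1 e', h2 e']
  exact ⟨key 2 (Or.inl rfl), key 3 (Or.inr rfl)⟩

/-! ### The moves -/

omit HG in
/-- `decide` of the switch coefficient. -/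
private theorem decide_coef (a g : Prop) [Decidable a] [Decidable g] (b : Bool) :
    decide ((if a then (1 : ZMod 2) else 0) + (if g then bit b else 0) = 1) = xor (decide a) (decide g && b) := by
  by_cases ha : a <;> by_cases hg : g <;> simp only [ha, hg, if_true, if_false, decide_true, decide_false] <;> cases b <;>
    (try simp only [bit]) <;> decide

omit HG in
/-- `decide` of the two-gate switch coefficient. -/
private theorem decide_coef₂ (a g g' : Prop) [Decidable a] [Decidable g] [Decidable g'] (b b' : Bool) :
    decide ((if a then (1 : ZMod 2) else 0) + (if g then bit b else 0) + (if g' then bit b' else 0) = 1) =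
      xor (decide a) (xor (decide g && b) (decide g' && b')) := by
  by_cases ha : a <;> by_cases hg : g <;> by_cases hg' : g' <;>
    simp only [ha, hg, hg', if_true, if_false, decide_true, decide_false] <;> cases b <;> cases b' <;> (try simp only [bit]) <;> decide

/-- **Move of `vᵢ`**: `mv vᵢ = [vᵢ ∈ C] ⊕ [gᵢ ∈ G]·x_z`. -/
theorem mvᵢ {G : Finset (Fin m)} (hG : G ⊆ M) (C : Finset (Fin n)) (x : Fin n → Bool) :
    mv I C G vᵢ x = xor (decide (vᵢ ∈ C)) (decide (gᵢ ∈ G) && x z) := by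
  unfold PstarChordReadFlip.mv
  rw [coef_switch I (Ne.symm HG.nes.1) HG.gateᵢ.symm (HG.otherᵢ hG), decide_coef]

/-- **Move of `vⱼ`**: `mv vⱼ = [vⱼ ∈ C] ⊕ [gⱼ ∈ G]·x_z`. -/
theorem mvⱼ {G : Finset (Fin m)} (hG : G ⊆ M) (C : Finset (Fin n)) (x : Fin n → Bool) :
    mv I C G vⱼ x = xor (decide (vⱼ ∈ C)) (decide (gⱼ ∈ G) && x z) := by
  unfold PstarChordReadFlip.mv
  rw [coef_switch I (Ne.symm HG.nes.2.2.2.2.1) HG.gateⱼ.symm (HG.otherⱼ hG), decide_coef]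

/-- **Move of `z`**: `mv z = [z ∈ C] ⊕ [gᵢ ∈ G]·x_{vᵢ} ⊕ [gⱼ ∈ G]·x_{vⱼ}`. -/
theorem mvz {G : Finset (Fin m)} (hG : G ⊆ M) (C : Finset (Fin n)) (x : Fin n → Bool) :
    mv I C G z x = xor (decide (z ∈ C)) (xor (decide (gᵢ ∈ G) && x vᵢ) (decide (gⱼ ∈ G) && x vⱼ)) := by
  unfold PstarChordReadFlip.mv
  rw [coef_switch₂ I HG.gne HG.nes.1 HG.nes.2.2.2.2.1 HG.gateᵢ HG.gateⱼ (HG.otherz hG), decide_coef₂]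

/-! ### Menu hygiene -/

/-- The `z`-free menu avoids the AND pair of `cᵢ`. -/
theorem monoᵢ : ∀ g ∈ avoid I M z,
    (I.vars g 2 ≠ I.vars cᵢ 2 ∧ I.vars g 3 ≠ I.vars cᵢ 2) ∧ (I.vars g 2 ≠ I.vars cᵢ 3 ∧ I.vars g 3 ≠ I.vars cᵢ 3) := by
  intro g hg
  obtain ⟨hgM, h2z, h3z⟩ := (mem_avoid I).1 hg
  have key : ∀ s : Fin 4, s = 2 ∨ s = 3 → ∀ u, (u = vᵢ ∨ u = vᵢ') → I.vars g s ≠ u := by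
    intro s hs u hu e
    have h5 : I.vars g s = vᵢ ∨ I.vars g s = vᵢ' ∨ I.vars g s = vⱼ ∨ I.vars g s = vⱼ' ∨ I.vars g s = z := by
      rcases hu with rfl | rfl
      exacts [Or.inl e, Or.inr (Or.inl e)]
    rcases HG.pure g hgM s hs h5 with rfl | rfl
    · rcases HG.gateᵢ with ⟨-, h3⟩ | ⟨h2, -⟩
      exacts [h3z h3, h2z h2]
    · rcases HG.gateⱼ with ⟨-, h3⟩ | ⟨h2, -⟩
      exacts [h3z h3, h2z h2]
  have hu2 : I.vars cᵢ 2 = vᵢ ∨ I.vars cᵢ 2 = vᵢ' := by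
    rcases HG.pairᵢ with ⟨h, -⟩ | ⟨h, -⟩
    exacts [Or.inl h, Or.inr h]
  have hu3 : I.vars cᵢ 3 = vᵢ ∨ I.vars cᵢ 3 = vᵢ' := by
    rcases HG.pairᵢ with ⟨-, h⟩ | ⟨-, h⟩
    exacts [Or.inr h, Or.inl h]
  exact ⟨⟨key 2 (Or.inl rfl) _ hu2, key 3 (Or.inr rfl) _ hu2⟩, ⟨key 2 (Or.inl rfl) _ hu3, key 3 (Or.inr rfl) _ hu3⟩⟩

/-- The `z`-free menu avoids the AND pair of `cⱼ`. -/
theorem monoⱼ : ∀ g ∈ avoid I M z,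
    (I.vars g 2 ≠ I.vars cⱼ 2 ∧ I.vars g 3 ≠ I.vars cⱼ 2) ∧ (I.vars g 2 ≠ I.vars cⱼ 3 ∧ I.vars g 3 ≠ I.vars cⱼ 3) := by
  intro g hg
  obtain ⟨hgM, h2z, h3z⟩ := (mem_avoid I).1 hg
  have key : ∀ s : Fin 4, s = 2 ∨ s = 3 → ∀ u, (u = vⱼ ∨ u = vⱼ') → I.vars g s ≠ u := by
    intro s hs u hu e
    have h5 : I.vars g s = vᵢ ∨ I.vars g s = vᵢ' ∨ I.vars g s = vⱼ ∨ I.vars g s = vⱼ' ∨ I.vars g s = z := by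
      rcases hu with rfl | rfl
      exacts [Or.inr (Or.inr (Or.inl e)), Or.inr (Or.inr (Or.inr (Or.inl e)))]
    rcases HG.pure g hgM s hs h5 with rfl | rfl
    · rcases HG.gateᵢ with ⟨-, h3⟩ | ⟨h2, -⟩
      exacts [h3z h3, h2z h2]
    · rcases HG.gateⱼ with ⟨-, h3⟩ | ⟨h2, -⟩
      exacts [h3z h3, h2z h2]
  have hu2 : I.vars cⱼ 2 = vⱼ ∨ I.vars cⱼ 2 = vⱼ' := by
    rcases HG.pairⱼ with ⟨h, -⟩ | ⟨h, -⟩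
    exacts [Or.inl h, Or.inr h]
  have hu3 : I.vars cⱼ 3 = vⱼ ∨ I.vars cⱼ 3 = vⱼ' := by
    rcases HG.pairⱼ with ⟨-, h⟩ | ⟨-, h⟩
    exacts [Or.inr h, Or.inl h]
  exact ⟨⟨key 2 (Or.inl rfl) _ hu2, key 3 (Or.inr rfl) _ hu2⟩, ⟨key 2 (Or.inl rfl) _ hu3, key 3 (Or.inr rfl) _ hu3⟩⟩

/-- No cross monomial `{vᵢ, vⱼ}` in the menu. -/
theorem ncross : ∀ h ∈ M, ¬ ((I.vars h 2 = vⱼ ∧ I.vars h 3 = vᵢ) ∨ (I.vars h 2 = vᵢ ∧ I.vars h 3 = vⱼ)) := by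
  obtain ⟨hᵢz, -, hᵢⱼ, -, hⱼz, -⟩ := HG.nes
  intro h hh hx
  have h5 : I.vars h 2 = vᵢ ∨ I.vars h 2 = vᵢ' ∨ I.vars h 2 = vⱼ ∨ I.vars h 2 = vⱼ' ∨ I.vars h 2 = z := by
    rcases hx with ⟨e, -⟩ | ⟨e, -⟩
    exacts [Or.inr (Or.inr (Or.inl e)), Or.inl e]
  rcases HG.pure h hh 2 (Or.inl rfl) h5 with rfl | rfl
  · rcases HG.gateᵢ with ⟨a2, a3⟩ | ⟨a2, a3⟩ <;> rcases hx with ⟨b2, b3⟩ | ⟨b2, b3⟩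
    · exact hᵢⱼ (a2.symm.trans b2)
    · exact hⱼz (b3.symm.trans a3)
    · exact hⱼz (b2.symm.trans a2)
    · exact hᵢz (b2.symm.trans a2)
  · rcases HG.gateⱼ with ⟨a2, a3⟩ | ⟨a2, a3⟩ <;> rcases hx with ⟨b2, b3⟩ | ⟨b2, b3⟩
    · exact hᵢz (b3.symm.trans a3)
    · exact hᵢⱼ (b2.symm.trans a2)
    · exact hⱼz (b2.symm.trans a2)
    · exact hᵢz (b2.symm.trans a2)

/-! ### The abstract hub data of any pair of readers with menu `M` -/

/-- **Hub gates deliver `HubData`** for every pair of readers whose menu is `M`, with the computed labels and types. -/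
theorem hubData {w₁ w₂ : Finset (Fin n) × Finset (Fin m) × Bool} (hM : w₁.2.1 ∪ w₂.2.1 = M) :
    HubData I y J₀ w₁ w₂ cᵢ cⱼ vᵢ vᵢ' vⱼ vⱼ' z (decide (vᵢ ∈ w₁.1)) (decide (vᵢ ∈ w₂.1)) (decide (vⱼ ∈ w₁.1)) (decide (vⱼ ∈ w₂.1))
      (decide (gᵢ ∈ w₁.2.1)) (decide (gᵢ ∈ w₂.2.1)) (decide (gⱼ ∈ w₁.2.1)) (decide (gⱼ ∈ w₂.2.1)) (decide (z ∈ w₁.1)) (decide (z ∈ w₂.1)) := by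
  have h₁ : w₁.2.1 ⊆ M := hM ▸ subset_union_left
  have h₂ : w₂.2.1 ⊆ M := hM ▸ subset_union_right
  exact
    { memᵢ := HG.memᵢ, memⱼ := HG.memⱼ, ne := HG.ne, chordᵢ := HG.chordᵢ, chordⱼ := HG.chordⱼ, pairᵢ := HG.pairᵢ, pairⱼ := HG.pairⱼ,
      out := HG.out, monoᵢ := hM ▸ HG.monoᵢ, monoⱼ := hM ▸ HG.monoⱼ, genᵢ := hM ▸ HG.genᵢ, genⱼ := hM ▸ HG.genⱼ,
      ncross := fun h hh => HG.ncross h (hM ▸ hh), mvᵢ₁ := HG.mvᵢ h₁ w₁.1, mvᵢ₂ := HG.mvᵢ h₂ w₂.1, mvⱼ₁ := HG.mvⱼ h₁ w₁.1,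
      mvⱼ₂ := HG.mvⱼ h₂ w₂.1, mvz₁ := HG.mvz h₁ w₁.1, mvz₂ := HG.mvz h₂ w₂.1 }

end HubGates

/-! ## The theorem -/
section Main

variable {I : LocalMap 4 n m} {r : ℕ} {y : Fin m → Bool} {J₀ : Finset (Fin m)} {cᵢ cⱼ f : Fin m} {vᵢ vᵢ' vⱼ vⱼ' z : Fin n} {gᵢ gⱼ : Fin m}

/-- **The two normal forms**: `gᵢ` of type `(1,0)` and `gⱼ` of type `(1,0)` or `(0,1)` for the readers `(W₁, W₂)`. -/
theorem false_of_hub_normal (hI : I.IsPure xorAndPred) (hT : Typed I) (hS : SimpleOverlap I) (hB : BoundaryExpanding r I)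
    {W₁ W₂ : Finset (Fin n) × Finset (Fin m) × Bool} (ht : Terminal I r y J₀ W₁ W₂)
    (HG : HubGates I y J₀ (W₁.2.1 ∪ W₂.2.1) cᵢ cⱼ vᵢ vᵢ' vⱼ vⱼ' z gᵢ gⱼ) (h₁ : gᵢ ∈ W₁.2.1) (h₂ : gᵢ ∉ W₂.2.1)
    (hⱼ : (gⱼ ∈ W₁.2.1 ∧ gⱼ ∉ W₂.2.1) ∨ (gⱼ ∉ W₁.2.1 ∧ gⱼ ∈ W₂.2.1)) (hf : f ∈ J₀) (hfᵢ : f ≠ cᵢ) (hfⱼ : f ≠ cⱼ) : False := by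
  have H := HG.hubData rfl
  rw [decide_eq_true h₁, decide_eq_false h₂] at H
  rcases hⱼ with ⟨b₁, b₂⟩ | ⟨b₁, b₂⟩
  · rw [decide_eq_true b₁, decide_eq_false b₂] at H
    exact false_of_hub_uniform hI hT hS hB ht H hf hfᵢ hfⱼ
  · rw [decide_eq_false b₁, decide_eq_true b₂] at H
    exact false_of_hub_mixed hI hS ht H hf hfᵢ hfⱼ

/-- **THE HUB TWO-CHORD THEOREM.**  Two slice-generic chords gated by a pure hub on a common outside partner: impossible in a terminal core
(given a third output `f ∈ J₀`). -/
theorem false_of_hub (hI : I.IsPure xorAndPred) (hT : Typed I) (hS : SimpleOverlap I) (hB : BoundaryExpanding r I)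
    {w₁ w₂ : Finset (Fin n) × Finset (Fin m) × Bool} (ht : Terminal I r y J₀ w₁ w₂)
    (HG : HubGates I y J₀ (w₁.2.1 ∪ w₂.2.1) cᵢ cⱼ vᵢ vᵢ' vⱼ vⱼ' z gᵢ gⱼ) (hgᵢ : gᵢ ∈ w₁.2.1 ∪ w₂.2.1) (hgⱼ : gⱼ ∈ w₁.2.1 ∪ w₂.2.1)
    (hf : f ∈ J₀) (hfᵢ : f ≠ cᵢ) (hfⱼ : f ≠ cⱼ) : False := by
  -- the six reader pairs: (w₁,w₂), (w₂,w₁), (w₁,s), (s,w₁), (w₂,s'), (s',w₂) with s = w₁ ⊕ w₂, s' = w₂ ⊕ w₁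
  have ht' := terminal_swap ht
  have hts := terminal_sum ht
  have hts' := terminal_sum ht'
  have hsw := terminal_swap hts
  have hsw' := terminal_swap hts'
  have eM' : w₂.2.1 ∪ w₁.2.1 = w₁.2.1 ∪ w₂.2.1 := union_comm _ _
  have eMs : w₁.2.1 ∪ w₁.2.1 ∆ w₂.2.1 = w₁.2.1 ∪ w₂.2.1 := union_symmDiff_eq _ _
  have eMs' : w₂.2.1 ∪ w₂.2.1 ∆ w₁.2.1 = w₁.2.1 ∪ w₂.2.1 := (union_symmDiff_eq _ _).trans eM'
  have esM : w₁.2.1 ∆ w₂.2.1 ∪ w₁.2.1 = w₁.2.1 ∪ w₂.2.1 := (union_comm _ _).trans eMs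
  have es'M : w₂.2.1 ∆ w₁.2.1 ∪ w₂.2.1 = w₁.2.1 ∪ w₂.2.1 := (union_comm _ _).trans eMs'
  have N := fun {W₁ W₂ : Finset (Fin n) × Finset (Fin m) × Bool} (hW : Terminal I r y J₀ W₁ W₂) (e : W₁.2.1 ∪ W₂.2.1 = w₁.2.1 ∪ w₂.2.1) =>
    false_of_hub_normal hI hT hS hB hW (HG.cast e.symm) (hf := hf) (hfᵢ := hfᵢ) (hfⱼ := hfⱼ)
  simp only [mem_union] at hgᵢ hgⱼ
  have ms : ∀ g : Fin m, g ∈ w₁.2.1 ∆ w₂.2.1 ↔ g ∈ w₁.2.1 ∧ g ∉ w₂.2.1 ∨ g ∈ w₂.2.1 ∧ g ∉ w₁.2.1 := fun g => mem_symmDiff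
  have ms' : ∀ g : Fin m, g ∈ w₂.2.1 ∆ w₁.2.1 ↔ g ∈ w₂.2.1 ∧ g ∉ w₁.2.1 ∨ g ∈ w₁.2.1 ∧ g ∉ w₂.2.1 := fun g => mem_symmDiff
  by_cases a₁ : gᵢ ∈ w₁.2.1 <;> by_cases a₂ : gᵢ ∈ w₂.2.1 <;> by_cases b₁ : gⱼ ∈ w₁.2.1 <;> by_cases b₂ : gⱼ ∈ w₂.2.1
  · -- (1,1;1,1): pair (w₁, s), uniform
    exact N hts eMs a₁ (by rw [ms]; tauto) (Or.inl ⟨b₁, by rw [ms]; tauto⟩)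
  · -- (1,1;1,0): pair (w₂, s'), mixed
    exact N hts' eMs' a₂ (by rw [ms']; tauto) (Or.inr ⟨b₂, by rw [ms']; tauto⟩)
  · -- (1,1;0,1): pair (w₁, s), mixed
    exact N hts eMs a₁ (by rw [ms]; tauto) (Or.inr ⟨b₁, by rw [ms]; tauto⟩)
  · exact absurd hgⱼ (by tauto)
  · -- (1,0;1,1): pair (s', w₂), mixed
    exact N hsw' es'M (by rw [ms']; tauto) a₂ (Or.inr ⟨by rw [ms']; tauto, b₂⟩)
  · -- (1,0;1,0): uniform
    exact N ht rfl a₁ a₂ (Or.inl ⟨b₁, b₂⟩)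
  · -- (1,0;0,1): mixed
    exact N ht rfl a₁ a₂ (Or.inr ⟨b₁, b₂⟩)
  · exact absurd hgⱼ (by tauto)
  · -- (0,1;1,1): pair (s, w₁), mixed
    exact N hsw esM (by rw [ms]; tauto) a₁ (Or.inr ⟨by rw [ms]; tauto, b₁⟩)
  · -- (0,1;1,0): pair (w₂, w₁), mixed
    exact N ht' eM' a₂ a₁ (Or.inr ⟨b₂, b₁⟩)
  · -- (0,1;0,1): pair (w₂, w₁), uniform
    exact N ht' eM' a₂ a₁ (Or.inl ⟨b₂, b₁⟩)
  · exact absurd hgⱼ (by tauto)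
  all_goals exact absurd hgᵢ (by tauto)

end Main

end Summit.PneNP.PneNP.Theorems.PstarChordReadHub
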